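import Mathlib
import Summits.Ventures.PercRepro2.V1SeriesClosure

/-! # The level Harris inequalities are closed under series and parallel composition
(seat mine-b, cell pub-perc-repro2; conjectures/MINE-B.md §20.6)

`LevelHarris r b`: every lower set `D` meets `{r ≥ j}` at least as often as `{b ≥ j}`, for every
level `j` (on a pattern cube: Harris–Kleitman twice and the colour swap).  Fibrewise,

  series (minima):  `#(D ∩ {r≥j}×{r′≥j}) ≥ #(D ∩ {b≥j}×{r′≥j}) ≥ #(D ∩ {b≥j}×{b′≥j})`,
  parallel (sums):  `#(D ∩ {r+r′≥j}) ≥ #(D ∩ {b+r′≥j}) ≥ #(D ∩ {b+b′≥j})`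

(`levelHarris_ser`, `levelHarris_par`), and `LevelHarris` implies the capped form `CapHarris` of
V1SeriesClosure.lean (`capHarris_of_levelHarris`).  Together with `downDom_ser` / `downDom_par`
this makes `DownDom ∧ LevelHarris` an invariant of series–parallel composition of labelled posets
(V1SP.lean). -/

namespace Summit.Ventures.PercRepro2.UHClosure

open Finset

variable {X Y : Type*}

/-- **Level Harris inequalities**: every lower set meets `{r ≥ j}` at least as often as `{b ≥ j}`
(for `j = 0` both counts are the size of the set). -/
def LevelHarris [Preorder X] (r b : X → ℕ) : Prop :=
  ∀ D : Finset X, IsLowerSet (↑D : Set X) → ∀ j : ℕ,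
    (D.filter (fun x => j ≤ b x)).card ≤ (D.filter (fun x => j ≤ r x)).card

/-- the indicator `[j ≤ f x]` -/
def indGe (j : ℕ) (f : X → ℕ) (x : X) : ℤ := if j ≤ f x then 1 else 0

/-- `min n β` counts the levels `1 ≤ j ≤ β` below `n` -/
lemma min_eq_card_filter' (n β : ℕ) : min n β = ((range β).filter (fun j => j + 1 ≤ n)).card := by
  have : (range β).filter (fun j => j + 1 ≤ n) = range (min n β) := by
    ext j; simp only [mem_filter, mem_range, lt_min_iff]; omega
  rw [this, card_range]

/-- a sum of capped labels is a sum of level counts -/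
lemma sum_min_eq' (D : Finset X) (f : X → ℕ) (β : ℕ) :
    ∑ x ∈ D, ((min (f x) β : ℕ) : ℤ) = ∑ j ∈ range β, ((D.filter (fun x => j + 1 ≤ f x)).card : ℤ) := by
  simp_rw [min_eq_card_filter', card_filter]
  push_cast
  rw [Finset.sum_comm]

/-- the level inequalities imply the capped ones -/
theorem capHarris_of_levelHarris [Preorder X] (r b : X → ℕ) (h : LevelHarris r b) : CapHarris r b := by
  intro D hD β
  rw [Finset.sum_sub_distrib, sum_min_eq', sum_min_eq', ← Finset.sum_sub_distrib]
  apply Finset.sum_nonneg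
  intro j _
  have := h D hD (j + 1)
  have h' : ((D.filter (fun x => j + 1 ≤ b x)).card : ℤ) ≤ ((D.filter (fun x => j + 1 ≤ r x)).card : ℤ) := by
    exact_mod_cast this
  linarith

section fibres

variable [Preorder X] [Preorder Y] [Fintype X] [Fintype Y] [DecidableEq X] [DecidableEq Y]

omit [Preorder X] [Preorder Y] [Fintype Y] in
/-- a level count over a fibre as an indicator sum -/
lemma card_filter_fibre_fst (D : Finset (X × Y)) (y : Y) (j : ℕ) (f : X → ℕ) :
    (((univ.filter (fun x : X => (x, y) ∈ D)).filter (fun x => j ≤ f x)).card : ℤ)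
      = ∑ x, ind D x y * indGe j f x := by
  rw [Finset.card_filter, Finset.sum_filter]
  push_cast
  apply Finset.sum_congr rfl
  intro x _
  unfold ind indGe
  split_ifs <;> simp

omit [Preorder X] [Preorder Y] [Fintype X] in
/-- a level count over a fibre as an indicator sum -/
lemma card_filter_fibre_snd (D : Finset (X × Y)) (x : X) (j : ℕ) (f : Y → ℕ) :
    (((univ.filter (fun y : Y => (x, y) ∈ D)).filter (fun y => j ≤ f y)).card : ℤ)
      = ∑ y, ind D x y * indGe j f y := by
  rw [Finset.card_filter, Finset.sum_filter]
  push_cast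
  apply Finset.sum_congr rfl
  intro y _
  unfold ind indGe
  split_ifs <;> simp

omit [Fintype Y] in
/-- the level inequality of `X` on the fibre over `y` -/
theorem fibre_fst_level (r b : X → ℕ) (hX : LevelHarris r b) (D : Finset (X × Y))
    (hD : IsLowerSet (↑D : Set (X × Y))) (y : Y) (j : ℕ) :
    ∑ x, ind D x y * indGe j b x ≤ ∑ x, ind D x y * indGe j r x := by
  have h := hX (univ.filter (fun x : X => (x, y) ∈ D)) (fibre_fst_isLowerSet D hD y) j
  rw [← card_filter_fibre_fst, ← card_filter_fibre_fst]
  exact_mod_cast h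

omit [Fintype X] in
/-- the level inequality of `Y` on the fibre over `x` -/
theorem fibre_snd_level (r' b' : Y → ℕ) (hY : LevelHarris r' b') (D : Finset (X × Y))
    (hD : IsLowerSet (↑D : Set (X × Y))) (x : X) (j : ℕ) :
    ∑ y, ind D x y * indGe j b' y ≤ ∑ y, ind D x y * indGe j r' y := by
  have h := hY (univ.filter (fun y : Y => (x, y) ∈ D)) (fibre_snd_isLowerSet D hD x) j
  rw [← card_filter_fibre_snd, ← card_filter_fibre_snd]
  exact_mod_cast h

omit [Preorder X] [Preorder Y] in
/-- a level count over `D` as a double indicator sum -/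
lemma card_filter_D (D : Finset (X × Y)) (P : X → Y → Prop) [DecidablePred (fun p : X × Y => P p.1 p.2)]
    [∀ x y, Decidable (P x y)] :
    ((D.filter (fun p : X × Y => P p.1 p.2)).card : ℤ)
      = ∑ x, ∑ y, ind D x y * (if P x y then 1 else 0) := by
  rw [Finset.card_filter]
  push_cast
  rw [sum_D_eq' D (fun x y => if P x y then 1 else 0)]

/-- **the level inequalities are closed under series composition** (minima) -/
theorem levelHarris_ser (r b : X → ℕ) (r' b' : Y → ℕ) (hX : LevelHarris r b) (hY : LevelHarris r' b') :
    LevelHarris (fun p : X × Y => min (r p.1) (r' p.2)) (fun p : X × Y => min (b p.1) (b' p.2)) := by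
  intro D hD j
  have e1 : ((D.filter (fun p : X × Y => j ≤ min (b p.1) (b' p.2))).card : ℤ)
      = ∑ x, ∑ y, ind D x y * (indGe j b x * indGe j b' y) := by
    rw [card_filter_D D (fun x y => j ≤ min (b x) (b' y))]
    apply Finset.sum_congr rfl; intro x _; apply Finset.sum_congr rfl; intro y _
    unfold indGe; simp only [le_min_iff]; split_ifs <;> simp_all
  have e2 : ((D.filter (fun p : X × Y => j ≤ min (r p.1) (r' p.2))).card : ℤ)
      = ∑ x, ∑ y, ind D x y * (indGe j r x * indGe j r' y) := by
    rw [card_filter_D D (fun x y => j ≤ min (r x) (r' y))]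
    apply Finset.sum_congr rfl; intro x _; apply Finset.sum_congr rfl; intro y _
    unfold indGe; simp only [le_min_iff]; split_ifs <;> simp_all
  -- middle term: [j ≤ b x]·[j ≤ r' y]
  have step1 : ∑ x, ∑ y, ind D x y * (indGe j b x * indGe j b' y)
      ≤ ∑ x, ∑ y, ind D x y * (indGe j b x * indGe j r' y) := by
    apply Finset.sum_le_sum; intro x _
    have hx : 0 ≤ indGe j b x := by unfold indGe; split_ifs <;> simp
    have := fibre_snd_level r' b' hY D hD x j
    calc ∑ y, ind D x y * (indGe j b x * indGe j b' y)
        = indGe j b x * ∑ y, ind D x y * indGe j b' y := by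
          rw [Finset.mul_sum]; apply Finset.sum_congr rfl; intro y _; ring
      _ ≤ indGe j b x * ∑ y, ind D x y * indGe j r' y := mul_le_mul_of_nonneg_left this hx
      _ = ∑ y, ind D x y * (indGe j b x * indGe j r' y) := by
          rw [Finset.mul_sum]; apply Finset.sum_congr rfl; intro y _; ring
  have step2 : ∑ x, ∑ y, ind D x y * (indGe j b x * indGe j r' y)
      ≤ ∑ x, ∑ y, ind D x y * (indGe j r x * indGe j r' y) := by
    rw [Finset.sum_comm, Finset.sum_comm (f := fun x y => ind D x y * (indGe j r x * indGe j r' y))]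
    apply Finset.sum_le_sum; intro y _
    have hy : 0 ≤ indGe j r' y := by unfold indGe; split_ifs <;> simp
    have := fibre_fst_level r b hX D hD y j
    calc ∑ x, ind D x y * (indGe j b x * indGe j r' y)
        = indGe j r' y * ∑ x, ind D x y * indGe j b x := by
          rw [Finset.mul_sum]; apply Finset.sum_congr rfl; intro x _; ring
      _ ≤ indGe j r' y * ∑ x, ind D x y * indGe j r x := mul_le_mul_of_nonneg_left this hy
      _ = ∑ x, ind D x y * (indGe j r x * indGe j r' y) := by
          rw [Finset.mul_sum]; apply Finset.sum_congr rfl; intro x _; ring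
  have : ((D.filter (fun p : X × Y => j ≤ min (b p.1) (b' p.2))).card : ℤ)
      ≤ ((D.filter (fun p : X × Y => j ≤ min (r p.1) (r' p.2))).card : ℤ) := by
    rw [e1, e2]; exact step1.trans step2
  exact_mod_cast this

omit [Preorder X] [Preorder Y] [Fintype X] [Fintype Y] [DecidableEq X] [DecidableEq Y] in
/-- `[j ≤ m + n] = [j − m ≤ n]` for naturals -/
lemma indGe_add (j m : ℕ) (f : Y → ℕ) (y : Y) :
    (if j ≤ m + f y then (1 : ℤ) else 0) = indGe (j - m) f y := by
  unfold indGe; split_ifs <;> omega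

/-- **the level inequalities are closed under parallel composition** (sums) -/
theorem levelHarris_par (r b : X → ℕ) (r' b' : Y → ℕ) (hX : LevelHarris r b) (hY : LevelHarris r' b') :
    LevelHarris (fun p : X × Y => r p.1 + r' p.2) (fun p : X × Y => b p.1 + b' p.2) := by
  intro D hD j
  have e1 : ((D.filter (fun p : X × Y => j ≤ b p.1 + b' p.2)).card : ℤ)
      = ∑ x, ∑ y, ind D x y * indGe (j - b x) b' y := by
    rw [card_filter_D D (fun x y => j ≤ b x + b' y)]
    apply Finset.sum_congr rfl; intro x _; apply Finset.sum_congr rfl; intro y _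
    rw [indGe_add]
  have e2 : ((D.filter (fun p : X × Y => j ≤ r p.1 + r' p.2)).card : ℤ)
      = ∑ y, ∑ x, ind D x y * indGe (j - r' y) r x := by
    rw [card_filter_D D (fun x y => j ≤ r x + r' y), Finset.sum_comm]
    apply Finset.sum_congr rfl; intro y _; apply Finset.sum_congr rfl; intro x _
    have : (if j ≤ r x + r' y then (1 : ℤ) else 0) = indGe (j - r' y) r x := by
      unfold indGe; split_ifs <;> omega
    rw [this]
  -- middle: [j ≤ b x + r' y]
  have em : ∑ x, ∑ y, ind D x y * indGe (j - b x) r' y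
      = ∑ y, ∑ x, ind D x y * indGe (j - r' y) b x := by
    rw [Finset.sum_comm]
    apply Finset.sum_congr rfl; intro y _; apply Finset.sum_congr rfl; intro x _
    unfold indGe; split_ifs <;> omega
  have step1 : ∑ x, ∑ y, ind D x y * indGe (j - b x) b' y ≤ ∑ x, ∑ y, ind D x y * indGe (j - b x) r' y := by
    apply Finset.sum_le_sum; intro x _
    exact fibre_snd_level r' b' hY D hD x (j - b x)
  have step2 : ∑ y, ∑ x, ind D x y * indGe (j - r' y) b x ≤ ∑ y, ∑ x, ind D x y * indGe (j - r' y) r x := by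
    apply Finset.sum_le_sum; intro y _
    exact fibre_fst_level r b hX D hD y (j - r' y)
  have : ((D.filter (fun p : X × Y => j ≤ b p.1 + b' p.2)).card : ℤ)
      ≤ ((D.filter (fun p : X × Y => j ≤ r p.1 + r' p.2)).card : ℤ) := by
    rw [e1, e2]; exact step1.trans (em ▸ step2)
  exact_mod_cast this

end fibres

end Summit.Ventures.PercRepro2.UHClosure
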